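import Literature.Analysis.FluidPDE.PeriodicLerayGalerkinSystem
import Mathlib.Topology.ContinuousMap.SecondCountableSpace
import Mathlib.Topology.UniformSpace.CompactConvergence
import Mathlib.Analysis.InnerProductSpace.PiL2
import HarnessLib

/-!
# Galerkin bases in the divergence-free test fields ([BT1] Lemma 2.6: "`{a_k} ⊂ 𝒱`")

Analysis/FluidPDE definition file, support layer for the Galerkin limit under the named fact
`Literature.Analysis.FluidPDE.bradshawTsai2017_thm_2_4_mollified` (Bradshaw–Tsai, Ann. Henri
Poincaré 18 (2017) = arXiv:1510.07504 [BT1], §2): "Let `{a_k}_{k∈ℕ} ⊂ 𝒱` be an orthonormal basis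
of `H`", `𝒱 = C^∞_{c,σ}` the smooth compactly supported divergence-free fields. What the Galerkin
method consumes of this sentence is (a) finite `L²`-orthonormal families in `𝒱` spanning an
increasing sequence of subspaces and (b) a density property of their union. This file supplies:

* `testDivFreeSubmodule` — `𝒱` as a submodule of `ℝ³ → ℝ³` (divergence-free test fields);
* `L2Span V hV` — a finite-dimensional subspace `V` of continuous compactly supported fields,
  retyped to carry the `L²` inner product `⟪v, w⟫ = ∫ ⟪v(y), w(y)⟫ dy` (an honest inner product:
  a continuous field with `∫|v|² = 0` vanishes), and `exists_orthonormal_family` — **every such `V`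
  has an `L²`-orthonormal basis** `a : Fin (dim V) → V` (Mathlib's `stdOrthonormalBasis`), in the
  integral form `∫⟪aᵢ, aⱼ⟫ = δᵢⱼ` consumed by `bradshawTsai2017_lemma_2_6`, with every `v ∈ V` a
  combination `Σ cᵢ aᵢ`;
* `exists_countable_dense_testDivFree` — **a countable family `σ : ℕ → 𝒱` which is `C¹`-dense with
  controlled supports**: every `ζ ∈ 𝒱` supported in `B̄(0,N)` is, for every `δ > 0`, `δ`-close in
  `sup |·| + sup |D·|` to some `σ n` supported in `B̄(0,N)` (separability of `C(ℝ³, ℝ³ × L(ℝ³,ℝ³))`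
  in the compact-open topology, Mathlib `ContinuousMap.instSecondCountableTopology`, applied to the
  graphs `y ↦ (ζ y, Dζ y)`). The spans `V_m = span{σ₀,…,σ_m} ⊂ 𝒱` are the Galerkin spaces.

## References

* Z. Bradshaw, T.-P. Tsai, Ann. Henri Poincaré 18 (2017) = arXiv:1510.07504, §2 (the Galerkin
  method: "`{a_k} ⊂ 𝒱` … an orthonormal basis of `H`") [BradshawTsai2017AHP].
* R. Temam, *Navier–Stokes Equations*, North-Holland 1977, Ch. III §3.2 (choice of the basis
  `w_j ∈ 𝒱`, "free and total in `V`").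
-/

noncomputable section

open MeasureTheory Set Function Filter Topology TopologicalSpace Metric Module
open scoped NNReal ENNReal InnerProductSpace RealInnerProductSpace

namespace Literature.Analysis.FluidPDE

/-- Local notation for physical space `ℝ³ = EuclideanSpace ℝ (Fin 3)`. -/
local notation "ℝ³" => EuclideanSpace ℝ (Fin 3)

namespace BradshawTsai2017

/-! ## `𝒱` as a submodule -/

/-- **`𝒱`, the divergence-free test fields, as a submodule** of `ℝ³ → ℝ³` ([BT1] §1, Notation:
"`𝒱 = C^∞_{c,σ}`"). [cite: BradshawTsai2017AHP, §1 Notation] -/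
def testDivFreeSubmodule : Submodule ℝ (ℝ³ → ℝ³) where
  carrier := {ζ | FunctionSpaces.IsTestFunctionOn (⊤ : Opens ℝ³) ζ ∧ VectorCalculus.IsDivFree ζ}
  add_mem' := by
    rintro f g ⟨hf, hfd⟩ ⟨hg, hgd⟩
    refine ⟨⟨hf.contDiff.add hg.contDiff, hf.hasCompactSupport.add hg.hasCompactSupport, by simp⟩,
      fun y => ?_⟩
    have hfd' : DifferentiableAt ℝ f y := (hf.contDiff.differentiable (by simp)) y
    have hgd' : DifferentiableAt ℝ g y := (hg.contDiff.differentiable (by simp)) y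
    have h1 := hfd y
    have h2 := hgd y
    simp only [VectorCalculus.divergence] at h1 h2 ⊢
    rw [fderiv_add hfd' hgd', ContinuousLinearMap.toLinearMap_add, map_add, h1, h2, add_zero]
  zero_mem' := ⟨FunctionSpaces.isTestFunctionOn_zero _, fun y => by simp [VectorCalculus.divergence]⟩
  smul_mem' := by
    rintro c f ⟨hf, hfd⟩
    refine ⟨⟨hf.contDiff.const_smul c, hf.hasCompactSupport.smul_left, by simp⟩, fun y => ?_⟩
    have hfd' : DifferentiableAt ℝ f y := (hf.contDiff.differentiable (by simp)) y
    have h1 := hfd y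
    simp only [VectorCalculus.divergence] at h1 ⊢
    rw [fderiv_const_smul hfd' c, ContinuousLinearMap.toLinearMap_smul, map_smul, h1, smul_zero]

/-- Membership in `𝒱`. [cite: BradshawTsai2017AHP, §1 Notation] -/
theorem mem_testDivFreeSubmodule {ζ : ℝ³ → ℝ³} :
    ζ ∈ testDivFreeSubmodule ↔
      FunctionSpaces.IsTestFunctionOn (⊤ : Opens ℝ³) ζ ∧ VectorCalculus.IsDivFree ζ := Iff.rfl

/-! ## An `L²`-orthonormal basis of a finite-dimensional space of continuous compactly supported fields -/

section L2

/-- `div (f + g) = div f + div g` is built into `testDivFreeSubmodule`; here: coercions of sums in a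
submodule of functions evaluate pointwise. [folklore] -/
theorem coe_finset_sum_apply {ι : Type*} (s : Finset ι) (V : Submodule ℝ (ℝ³ → ℝ³)) (f : ι → V)
    (y : ℝ³) : ((∑ i ∈ s, f i : V) : ℝ³ → ℝ³) y = ∑ i ∈ s, (f i : ℝ³ → ℝ³) y := by
  rw [Submodule.coe_sum, Finset.sum_apply]

/-- **Every finite-dimensional space of continuous compactly supported fields has an
`L²`-orthonormal basis**: a family `a : Fin k → V`, `k = dim V`, with `∫⟪aᵢ, aⱼ⟫ = δᵢⱼ` such that
every `v ∈ V` is `Σᵢ cᵢ aᵢ` — Mathlib's `stdOrthonormalBasis` for the `L²` inner product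
`⟪v, w⟫ = ∫⟪v(y), w(y)⟫dy` on `V` (an honest inner product: a continuous field with `∫|v|² = 0`
vanishes). These are the first `k` members of "`{a_k} ⊂ 𝒱` … an orthonormal basis of `H`" as
consumed by Lemma 2.6. [cite: BradshawTsai2017AHP, §2 (Galerkin method)] -/
theorem exists_orthonormal_family (V : Submodule ℝ (ℝ³ → ℝ³)) [FiniteDimensional ℝ V]
    (hV : ∀ v ∈ V, Continuous v ∧ HasCompactSupport v) :
    ∃ (k : ℕ) (a : Fin k → ℝ³ → ℝ³), (∀ i, a i ∈ V) ∧
      (∀ i j, ∫ y, ⟪a i y, a j y⟫ = if i = j then (1 : ℝ) else 0) ∧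
      ∀ v ∈ V, ∃ c : Fin k → ℝ, v = fun y => ∑ i, c i • a i y := by
  -- integrability of the pairings
  have hint : ∀ v w : V, Integrable (fun y => ⟪(v : ℝ³ → ℝ³) y, (w : ℝ³ → ℝ³) y⟫)
      (volume : Measure ℝ³) := fun v w =>
    ((hV _ v.2).1.inner (hV _ w.2).1).integrable_of_hasCompactSupport
      ((hV _ w.2).2.mono fun y hy => by contrapose! hy; simp_all)
  -- the `L²` inner product on `V`
  letI instI : Inner ℝ V := ⟨fun v w => ∫ y, ⟪(v : ℝ³ → ℝ³) y, (w : ℝ³ → ℝ³) y⟫⟩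
  have hinner : ∀ v w : V, ⟪v, w⟫ = ∫ y, ⟪(v : ℝ³ → ℝ³) y, (w : ℝ³ → ℝ³) y⟫ := fun v w => rfl
  let core : InnerProductSpace.Core ℝ V :=
    { toInner := instI
      conj_inner_symm := fun v w => by
        simp only [hinner, conj_trivial]
        exact integral_congr_ae (Eventually.of_forall fun y => real_inner_comm _ _)
      re_inner_nonneg := fun v => by
        simp only [hinner, RCLike.re_to_real]
        exact integral_nonneg fun y => real_inner_self_nonneg
      add_left := fun v w z => by
        simp only [hinner, Submodule.coe_add, Pi.add_apply, inner_add_left]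
        exact integral_add (hint v z) (hint w z)
      smul_left := fun v w c => by
        simp only [hinner, Submodule.coe_smul, Pi.smul_apply, real_inner_smul_left, conj_trivial]
        exact integral_const_mul _ _
      definite := fun v hv => by
        simp only [hinner, real_inner_self_eq_norm_sq] at hv
        have hi2 : Integrable (fun y => ‖(v : ℝ³ → ℝ³) y‖ ^ 2) (volume : Measure ℝ³) :=
          (hint v v).congr (Eventually.of_forall fun y => real_inner_self_eq_norm_sq _)
        have h0 := (integral_eq_zero_iff_of_nonneg (fun y => sq_nonneg _) hi2).1 hv
        have hc : Continuous fun y => ‖(v : ℝ³ → ℝ³) y‖ ^ 2 := (hV _ v.2).1.norm.pow 2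
        have h1 : (fun y => ‖(v : ℝ³ → ℝ³) y‖ ^ 2) = 0 :=
          (hc.ae_eq_iff_eq volume continuous_const).1 h0
        ext y
        have h2 : ‖(v : ℝ³ → ℝ³) y‖ ^ 2 = 0 := congr_fun h1 y
        have h3 : (v : ℝ³ → ℝ³) y = 0 := norm_eq_zero.1 (pow_eq_zero_iff two_ne_zero |>.1 h2)
        rw [h3]
        rfl }
  letI instN : NormedAddCommGroup V := @InnerProductSpace.Core.toNormedAddCommGroup ℝ V _ _ _ core
  letI instP : InnerProductSpace ℝ V := InnerProductSpace.ofCore _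
  -- the orthonormal basis
  let b := stdOrthonormalBasis ℝ V
  refine ⟨finrank ℝ V, fun i => (b i : ℝ³ → ℝ³), fun i => (b i).2, fun i j => ?_, fun v hv => ?_⟩
  · rw [← hinner, b.inner_eq_ite]
  · set w : V := ⟨v, hv⟩ with hw
    refine ⟨fun i => ⟪b i, w⟫, ?_⟩
    have h := b.sum_repr' w
    have h' : ((∑ i, ⟪b i, w⟫ • b i : V) : ℝ³ → ℝ³) = v := by rw [h]
    funext y
    rw [← congr_fun h' y, coe_finset_sum_apply]
    simp only [Submodule.coe_smul, Pi.smul_apply]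

end L2

/-! ## A countable `C¹`-dense family in `𝒱` with controlled supports -/

section Dense

/-- The level-`N` part of `𝒱`: divergence-free test fields supported in the closed ball
`B̄(0, N)`. [cite: BradshawTsai2017AHP, §1 Notation] -/
def levelSet (N : ℕ) : Set (ℝ³ → ℝ³) :=
  {ζ | ζ ∈ testDivFreeSubmodule ∧ tsupport ζ ⊆ closedBall (0 : ℝ³) N}

/-- The zero field lies in every level. [folklore] -/
theorem zero_mem_levelSet (N : ℕ) : (0 : ℝ³ → ℝ³) ∈ levelSet N :=
  ⟨testDivFreeSubmodule.zero_mem, by simp⟩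

/-- Off the ball `B̄(0,N)` a level-`N` field and its derivative vanish. [folklore] -/
theorem levelSet.eq_zero_of_notMem {N : ℕ} {ζ : ℝ³ → ℝ³} (hζ : ζ ∈ levelSet N) {y : ℝ³}
    (hy : y ∉ closedBall (0 : ℝ³) N) : ζ y = 0 ∧ fderiv ℝ ζ y = 0 :=
  ⟨image_eq_zero_of_notMem_tsupport fun h => hy (hζ.2 h),
    fderiv_of_notMem_tsupport ℝ fun h => hy (hζ.2 h)⟩

/-- **The graph map** `ζ ↦ (y ↦ (ζ(y), Dζ(y)))` of a level into the continuous maps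
`C(ℝ³, ℝ³ × L(ℝ³, ℝ³))` (compact-open topology), through which the `C¹`-sup distance on a level
is read off. [folklore] -/
def graphMap (N : ℕ) (ζ : levelSet N) : C(ℝ³, ℝ³ × (ℝ³ →L[ℝ] ℝ³)) :=
  ⟨fun y => (ζ.1 y, fderiv ℝ ζ.1 y),
    ζ.2.1.1.contDiff.continuous.prodMk (ζ.2.1.1.contDiff.continuous_fderiv (by simp))⟩

/-- Evaluation of the graph map. [folklore] -/
@[simp] theorem graphMap_apply (N : ℕ) (ζ : levelSet N) (y : ℝ³) :
    graphMap N ζ y = (ζ.1 y, fderiv ℝ ζ.1 y) := rfl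

/-- **Countable `C¹`-density on each level.** There is a countable `S ⊆ levelSet N` such that every
level-`N` field is, for every `δ > 0`, within `δ` of some member of `S` in `sup|·| + sup|D·|`
(separability of `C(ℝ³, ℝ³ × L(ℝ³,ℝ³))`, Mathlib `ContinuousMap.instSecondCountableTopology`,
restricted to the image of the level under the graph map; compact-open convergence is uniform
convergence on the compact `B̄(0,N)`, off which everything vanishes). [folklore] -/
theorem exists_countable_dense_level (N : ℕ) :
    ∃ S : Set (ℝ³ → ℝ³), S.Countable ∧ S ⊆ levelSet N ∧
      ∀ ζ ∈ levelSet N, ∀ δ : ℝ, 0 < δ → ∃ σ ∈ S,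
        ∀ y, ‖ζ y - σ y‖ ≤ δ ∧ ‖fderiv ℝ ζ y - fderiv ℝ σ y‖ ≤ δ := by
  set A : Set C(ℝ³, ℝ³ × (ℝ³ →L[ℝ] ℝ³)) := range (graphMap N) with hA
  -- a countable dense subset of the image, in the subspace topology
  obtain ⟨D, hDc, hDd⟩ := TopologicalSpace.exists_countable_dense A
  -- preimages in the level
  have hpre : ∀ d : A, ∃ ζ : levelSet N, graphMap N ζ = d.1 := fun d => mem_range.1 d.2
  choose pre hpre using hpre
  refine ⟨(fun d => (pre d : ℝ³ → ℝ³)) '' D, hDc.image _, ?_, ?_⟩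
  · rintro _ ⟨d, -, rfl⟩
    exact (pre d).2
  · intro ζ hζ δ hδ
    set x : C(ℝ³, ℝ³ × (ℝ³ →L[ℝ] ℝ³)) := graphMap N ⟨ζ, hζ⟩ with hx
    have hxA : x ∈ A := mem_range_self _
    -- a sequence of `D` converging to `x`
    have hcl : (⟨x, hxA⟩ : A) ∈ closure D := hDd _
    obtain ⟨u, huD, hu⟩ := mem_closure_iff_seq_limit.1 hcl
    have hu' : Tendsto (fun n => ((u n : A) : C(ℝ³, ℝ³ × (ℝ³ →L[ℝ] ℝ³)))) atTop (𝓝 x) :=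
      tendsto_subtype_rng.1 hu
    -- uniform convergence on the closed ball
    have hunif := (ContinuousMap.tendsto_iff_forall_isCompact_tendstoUniformlyOn.1 hu')
      (closedBall (0 : ℝ³) N) (isCompact_closedBall _ _)
    rw [Metric.tendstoUniformlyOn_iff] at hunif
    obtain ⟨n, hn⟩ := (hunif δ hδ).exists
    refine ⟨pre (u n), mem_image_of_mem _ (huD n), fun y => ?_⟩
    have hgraph : graphMap N (pre (u n)) = (u n : C(ℝ³, ℝ³ × (ℝ³ →L[ℝ] ℝ³))) := hpre (u n)
    by_cases hy : y ∈ closedBall (0 : ℝ³) N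
    · have h := hn y hy
      rw [← hgraph, hx, graphMap_apply, graphMap_apply, Prod.dist_eq, max_lt_iff, dist_eq_norm,
        dist_eq_norm] at h
      exact ⟨h.1.le, h.2.le⟩
    · obtain ⟨h1, h2⟩ := levelSet.eq_zero_of_notMem hζ hy
      obtain ⟨h3, h4⟩ := levelSet.eq_zero_of_notMem (pre (u n)).2 hy
      rw [h1, h2, h3, h4, sub_zero, sub_zero, norm_zero, norm_zero]
      exact ⟨hδ.le, hδ.le⟩

/-- **A countable `C¹`-dense family in `𝒱` with controlled supports** — the tree's rendering of
the separable choice behind "`{a_k} ⊂ 𝒱` … an orthonormal basis of `H`": a sequence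
`σ : ℕ → 𝒱` such that every `ζ ∈ 𝒱` supported in `B̄(0,N)` is, for every `δ > 0`, `δ`-close in
`sup|·| + sup|D·|` to some `σ n` which is itself supported in `B̄(0,N)`. [cite: BradshawTsai2017AHP, §2 (Galerkin method)] -/
theorem exists_countable_dense_testDivFree :
    ∃ σ : ℕ → (ℝ³ → ℝ³), (∀ n, σ n ∈ testDivFreeSubmodule) ∧
      ∀ (N : ℕ) (ζ : ℝ³ → ℝ³), ζ ∈ testDivFreeSubmodule → tsupport ζ ⊆ closedBall (0 : ℝ³) N →
        ∀ δ : ℝ, 0 < δ → ∃ n, tsupport (σ n) ⊆ closedBall (0 : ℝ³) N ∧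
          ∀ y, ‖ζ y - σ n y‖ ≤ δ ∧ ‖fderiv ℝ ζ y - fderiv ℝ (σ n) y‖ ≤ δ := by
  choose S hSc hSsub hSd using exists_countable_dense_level
  set T : Set (ℝ³ → ℝ³) := ⋃ N, S N with hT
  have hTc : T.Countable := countable_iUnion hSc
  have hTne : T.Nonempty := by
    obtain ⟨σ, hσ, -⟩ := hSd 0 0 (zero_mem_levelSet 0) 1 one_pos
    exact ⟨σ, mem_iUnion.2 ⟨0, hσ⟩⟩
  obtain ⟨σ, hσ⟩ := hTc.exists_eq_range hTne
  refine ⟨σ, fun n => ?_, fun N ζ hζ hsupp δ hδ => ?_⟩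
  · have : σ n ∈ T := hσ ▸ mem_range_self n
    obtain ⟨N, hN⟩ := mem_iUnion.1 this
    exact (hSsub N hN).1
  · obtain ⟨τ, hτ, hclose⟩ := hSd N ζ ⟨hζ, hsupp⟩ δ hδ
    have : τ ∈ T := mem_iUnion.2 ⟨N, hτ⟩
    rw [hσ] at this
    obtain ⟨n, rfl⟩ := this
    exact ⟨n, (hSsub N hτ).2, hclose⟩

end Dense

/-! ## The Galerkin spaces `V_m = span{σ₀, …, σ_m}` -/

section Spaces

/-- Members of `𝒱` are continuous with compact support. [folklore] -/
theorem continuous_and_hasCompactSupport_of_mem {v : ℝ³ → ℝ³} (hv : v ∈ testDivFreeSubmodule) :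
    Continuous v ∧ HasCompactSupport v :=
  ⟨hv.1.contDiff.continuous, hv.1.hasCompactSupport⟩

/-- **The Galerkin spaces** `V_m = span{σ₀, …, σ_m}` of a sequence of fields (the span of "the
first members of `{a_k}`"). [cite: BradshawTsai2017AHP, §2 (Galerkin method)] -/
def galerkinSpace (σ : ℕ → ℝ³ → ℝ³) (m : ℕ) : Submodule ℝ (ℝ³ → ℝ³) :=
  Submodule.span ℝ (σ '' Iic m)

/-- The Galerkin spaces are finite dimensional. [folklore] -/
instance finiteDimensional_galerkinSpace (σ : ℕ → ℝ³ → ℝ³) (m : ℕ) :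
    FiniteDimensional ℝ (galerkinSpace σ m) :=
  FiniteDimensional.span_of_finite ℝ ((finite_Iic m).image σ)

/-- `σ n ∈ V_m` for `n ≤ m`. [folklore] -/
theorem mem_galerkinSpace {σ : ℕ → ℝ³ → ℝ³} {n m : ℕ} (hn : n ≤ m) : σ n ∈ galerkinSpace σ m :=
  Submodule.subset_span ⟨n, hn, rfl⟩

/-- The Galerkin spaces increase. [folklore] -/
theorem galerkinSpace_mono (σ : ℕ → ℝ³ → ℝ³) : Monotone (galerkinSpace σ) := fun _ _ h =>
  Submodule.span_mono (image_mono (Iic_subset_Iic.2 h))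

/-- The Galerkin spaces of a sequence in `𝒱` lie in `𝒱`. [folklore] -/
theorem galerkinSpace_le {σ : ℕ → ℝ³ → ℝ³} (hσ : ∀ n, σ n ∈ testDivFreeSubmodule) (m : ℕ) :
    galerkinSpace σ m ≤ testDivFreeSubmodule :=
  Submodule.span_le.2 (by rintro _ ⟨n, -, rfl⟩; exact hσ n)

/-- **Orthonormal bases of the Galerkin spaces**: for a sequence in `𝒱`, every `V_m` has an
`L²`-orthonormal basis of divergence-free test fields `a : Fin k → 𝒱` (`∫⟪aᵢ,aⱼ⟫ = δᵢⱼ`) with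
every member of `V_m` a combination `Σ cᵢ aᵢ` — the finite orthonormal families fed to
`bradshawTsai2017_lemma_2_6`. [cite: BradshawTsai2017AHP, §2 (Galerkin method), Lemma 2.6] -/
theorem exists_orthonormal_family_galerkinSpace {σ : ℕ → ℝ³ → ℝ³}
    (hσ : ∀ n, σ n ∈ testDivFreeSubmodule) (m : ℕ) :
    ∃ (k : ℕ) (a : Fin k → ℝ³ → ℝ³), (∀ i, a i ∈ galerkinSpace σ m) ∧
      (∀ i, FunctionSpaces.IsTestFunctionOn (⊤ : Opens ℝ³) (a i)) ∧
      (∀ i, VectorCalculus.IsDivFree (a i)) ∧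
      (∀ i j, ∫ y, ⟪a i y, a j y⟫ = if i = j then (1 : ℝ) else 0) ∧
      ∀ v ∈ galerkinSpace σ m, ∃ c : Fin k → ℝ, v = fun y => ∑ i, c i • a i y := by
  obtain ⟨k, a, hamem, hon, hspan⟩ := exists_orthonormal_family (galerkinSpace σ m)
    fun v hv => continuous_and_hasCompactSupport_of_mem (galerkinSpace_le hσ m hv)
  exact ⟨k, a, hamem, fun i => (galerkinSpace_le hσ m (hamem i)).1,
    fun i => (galerkinSpace_le hσ m (hamem i)).2, hon, hspan⟩

end Spaces

end BradshawTsai2017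

end Literature.Analysis.FluidPDE
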